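import Summits.BirchSwinnertonDyer.BirchSwinnertonDyer.Theorems.PrintCf2DisegniPairTwoChiLineValues
import Literature.NumberTheory.EllipticCurves.PAdicLFunctionIntegralityAtTwoProofs
import HarnessLib

/-!
# Road (C) `disegni-pair-two` on crux stmt-BirchSwinnertonDyer-20368 — STEP A₂ at `p = 2`: the points of
# the `χ₈ ∘ N`-line and Disegni's interpolation values there as products of two Mazur–Tate–Teitelbaum values

Cell `bsd-print-cf2`, width seat `bsd-line-cf2-p1-w8` g21; sibling of `PrintCf2DisegniPairTwoChiLineValues.lean`
(§1: the two value identities at a split prime, any `p`). THEOREMS ONLY (no `def`, no named fact, no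
`sorry`); `--supports stmt-BirchSwinnertonDyer-20368`. BSD is not proved by any of this.

§2 (`p = 2`, the points of the `χ₈∘N`-line): the character bookkeeping of the typed range of
`Disegni2017.ChiLineInterpolation` «`θ` mod `2^{m+1}` even, of `2`-power order, primitive unless `m = 0`»:
`m = 0 ⇒ θ = 1` (`dirichletCharacter_level_two_eq_one`); no even primitive `θ` mod `4`
(`not_isPrimitive_of_even_level_four`); even primitive mod `8 ⇒ θ = χ₈` (`eq_chi8_of_even_of_isPrimitive`);
for `m ≥ 3`, `ξ := θ·χ₈` is primitive mod `2^{m+1}` (`isPrimitive_mul_chi8_changeLevel`); every character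
of `2`-power level has `2`-power order (`exists_orderOf_eq_two_pow`); the line character at `θ` is
`χ₈∘N · θ∘N = (θχ₈)∘N` (`baseChangeDirichlet_chi8_mul`), `= 𝟙` at `θ = χ₈` (`baseChangeDirichlet_chi8_mul_self`);
and the POINTS: `cycLinePoint ι (θχ₈) = −cycLinePoint ι θ − 2` (`cycLinePoint_mul_chi8`; `χ₈(5) = −1`: the
`χ₈`-coset of the cyclotomic variable is the reflection `T ↦ −T−2` of the open disc, `‖2‖₂ < 1`).
§3 (`p = 2`, STEP A₂ proper): `chiLineValue` at the three kinds of points `= c ·` (MTT value of `f`) `·`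
(MTT value of `f′`), `c = ι⁻¹(u·Car·Ω⁺_f·Ω⁺_{f′})`: `chiLineValue_chi8_level_two` (`θ = 1`: both
factors at the conductor-`8` character, `T = −2`), `chiLineValue_chi8_self` (`θ = χ₈`: both factors at
`T = 0`, Euler factors `(1−α⁻¹)²`), `chiLineValue_chi8_of_three_le` (`m ≥ 3`: both factors at the twin of
`ξ = θχ₈`, `T = −(pt θ) − 2`).

References: [Disegni2017] Thm. A (arXiv v3 PDF pp. 6–7), §1.2; [MazurTateTeitelbaum1986Invent] §I.8 (8.6),
§I.13, §I.14 (14.3); [MontgomeryVaughan2007] §9.1; [NeukirchANT1999] VII (6.9); cell PREGRADE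
`bsd-print-cf2-plan/PREGRADE-disegni-pair-two-skeleton-g24.md` §5.
-/

set_option autoImplicit false
set_option linter.dupNamespace false

noncomputable section

open scoped Classical MatrixGroups ModularForm NumberField

open CongruenceSubgroup NumberField IsDedekindDomain Literature.NumberTheory.EllipticCurves
  Literature.NumberTheory.EllipticCurves.ModularForms
  Literature.NumberTheory.EllipticCurves.Disegni2017 Literature.NumberTheory.GaloisRepresentations

namespace Summit.BirchSwinnertonDyer.BirchSwinnertonDyer.Theorems.PrintCf2.DisegniPairTwo

/-! ### §2 `p = 2`: the points of the `χ₈ ∘ N`-line -/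

section TwoPoints

/-- **Every Dirichlet character mod `2` is trivial** (`(ℤ/2)^× = 1`): the point `m = 0` of the typed
range is `θ = 𝟙`. [cite: MazurTateTeitelbaum1986Invent, §I.13] -/
theorem dirichletCharacter_level_two_eq_one {R : Type*} [CommMonoidWithZero R]
    (θ : DirichletCharacter R (2 ^ (0 + 1))) : θ = 1 := by
  haveI : Fact (1 < 2 ^ (0 + 1)) := ⟨by norm_num⟩
  refine MulChar.ext fun u ↦ ?_
  have h : ∀ x : ZMod (2 ^ (0 + 1)), x ≠ 0 → x = 1 := by decide
  have hu : u = 1 := Units.ext (h _ (Units.ne_zero u))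
  rw [hu, Units.val_one, map_one, map_one]

/-- **There is no EVEN primitive Dirichlet character mod `4`** (the only non-trivial character mod `4`
is `χ₋₄`, which is odd): the point `m = 1` of the typed range is empty.
[cite: MontgomeryVaughan2007, §9.1 (primitive characters)] -/
theorem not_isPrimitive_of_even_level_four (θ : DirichletCharacter ℂ (2 ^ (1 + 1))) (heven : θ.Even) :
    ¬ θ.IsPrimitive := by
  have hθ : θ = 1 := by
    refine MulChar.ext fun u ↦ ?_
    have h : ∀ x y : ZMod (2 ^ (1 + 1)), x * y = 1 → x = 1 ∨ x = -1 := by decide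
    rw [MulChar.one_apply_coe]
    rcases h _ _ u.mul_inv with h1 | h1
    · rw [h1, map_one]
    · rw [h1]; exact heven
  rw [hθ, DirichletCharacter.isPrimitive_def, DirichletCharacter.conductor_one]
  norm_num

/-- `χ₈ ⊗ ℂ` is EVEN (`χ₈(−1) = χ₈(7) = 1`), at any level presentation `2^{m+1}`, `m ≥ 2`, and in
particular at level `8 = 2³`. [cite: MontgomeryVaughan2007, §9.1] -/
theorem chi8_changeLevel_even {m : ℕ} (h8 : 8 ∣ 2 ^ (m + 1)) :
    (DirichletCharacter.changeLevel h8 (ZMod.χ₈.ringHomComp (Int.castRingHom ℂ))).Even := by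
  have hcop : IsCoprime (-1 : ℤ) ((2 ^ (m + 1) : ℕ) : ℤ) := isCoprime_one_left.neg_left
  rw [DirichletCharacter.Even, show (-1 : ZMod (2 ^ (m + 1))) = ((-1 : ℤ) : ZMod (2 ^ (m + 1))) by
    rw [Int.cast_neg, Int.cast_one], DirichletCharacter.changeLevel_eq_cast_of_dvd' _ h8 hcop,
    Int.cast_neg, Int.cast_one, MulChar.ringHomComp_apply]
  have h : ZMod.χ₈ (-1 : ZMod 8) = 1 := by decide
  rw [h, map_one]

/-- `χ₈ ⊗ ℂ` at level `2³` is even. [cite: MontgomeryVaughan2007, §9.1] -/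
theorem chi8_even :
    DirichletCharacter.Even (ZMod.χ₈.ringHomComp (Int.castRingHom ℂ) : DirichletCharacter ℂ (2 ^ 3)) := by
  show (ZMod.χ₈.ringHomComp (Int.castRingHom ℂ)) (-1 : ZMod 8) = 1
  rw [MulChar.ringHomComp_apply]
  have h : ZMod.χ₈ (-1 : ZMod 8) = 1 := by decide
  rw [h, map_one]

/-- `χ₈ ⊗ ℂ` takes the value `−1` at `5`, at any level `2^{m+1}`, `m ≥ 2`.
[cite: MontgomeryVaughan2007, §9.1] -/
theorem chi8_changeLevel_five {m : ℕ} (h8 : 8 ∣ 2 ^ (m + 1)) :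
    (DirichletCharacter.changeLevel h8 (ZMod.χ₈.ringHomComp (Int.castRingHom ℂ)))
      ((5 : ℕ) : ZMod (2 ^ (m + 1))) = -1 := by
  have hcop : Nat.Coprime 5 (2 ^ (m + 1)) := Nat.Coprime.pow_right _ (by norm_num)
  rw [← ZMod.coe_unitOfCoprime 5 hcop, DirichletCharacter.changeLevel_eq_cast_of_dvd,
    ZMod.coe_unitOfCoprime, ZMod.cast_natCast h8, MulChar.ringHomComp_apply]
  have h : ZMod.χ₈ ((5 : ℕ) : ZMod 8) = -1 := by decide
  rw [h, map_neg, map_one]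

/-- **An even primitive Dirichlet character mod `8` IS `χ₈`** (the even characters mod `8` are `𝟙` and
`χ₈`; `𝟙` is not primitive): the point `m = 2` of the typed range is `θ = χ₈`, at which the line
character `χ₈∘N · θ∘N` is TRIVIAL. [cite: MontgomeryVaughan2007, §9.1 (primitive characters)] -/
theorem eq_chi8_of_even_of_isPrimitive (θ : DirichletCharacter ℂ (2 ^ (2 + 1))) (heven : θ.Even)
    (hprim : θ.IsPrimitive) :
    θ = (ZMod.χ₈.ringHomComp (Int.castRingHom ℂ) : DirichletCharacter ℂ (2 ^ 3)) := by
  have h7 : θ (7 : ZMod (2 ^ (2 + 1))) = 1 := by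
    have : (7 : ZMod (2 ^ (2 + 1))) = -1 := by decide
    rw [this]; exact heven
  have hcases : ∀ x y : ZMod (2 ^ (2 + 1)), x * y = 1 → x = 1 ∨ x = 3 ∨ x = 5 ∨ x = 7 := by decide
  have h35 : (3 : ZMod (2 ^ (2 + 1))) = 5 * 7 := by decide
  -- `θ(5) = −1`, for otherwise `θ = 1` is not primitive
  have h5 : θ (5 : ZMod (2 ^ (2 + 1))) = -1 := by
    have hsq : θ (5 : ZMod (2 ^ (2 + 1))) ^ 2 = 1 := by
      rw [← map_pow, show (5 : ZMod (2 ^ (2 + 1))) ^ 2 = 1 by decide, map_one]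
    rcases sq_eq_one_iff.mp hsq with h1 | h1
    · exfalso
      have hθ : θ = 1 := by
        refine MulChar.ext fun u ↦ ?_
        rw [MulChar.one_apply_coe]
        rcases hcases _ _ u.mul_inv with h | h | h | h <;> rw [h]
        · exact map_one θ
        · rw [h35, map_mul, h1, h7, one_mul]
        · exact h1
        · exact h7
      rw [hθ, DirichletCharacter.isPrimitive_def, DirichletCharacter.conductor_one] at hprim
      norm_num at hprim
    · exact h1
  -- compare with `χ₈` on the four units
  have e1 : (ZMod.χ₈.ringHomComp (Int.castRingHom ℂ)) (1 : ZMod 8) = 1 := map_one _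
  have e3 : (ZMod.χ₈.ringHomComp (Int.castRingHom ℂ)) (3 : ZMod 8) = -1 := by
    rw [MulChar.ringHomComp_apply, show ZMod.χ₈ (3 : ZMod 8) = -1 by decide, map_neg, map_one]
  have e5 : (ZMod.χ₈.ringHomComp (Int.castRingHom ℂ)) (5 : ZMod 8) = -1 := by
    rw [MulChar.ringHomComp_apply, show ZMod.χ₈ (5 : ZMod 8) = -1 by decide, map_neg, map_one]
  have e7 : (ZMod.χ₈.ringHomComp (Int.castRingHom ℂ)) (7 : ZMod 8) = 1 := by
    rw [MulChar.ringHomComp_apply, show ZMod.χ₈ (7 : ZMod 8) = 1 by decide, map_one]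
  refine MulChar.ext fun u ↦ ?_
  rcases hcases _ _ u.mul_inv with h | h | h | h <;> rw [h]
  · rw [map_one]; exact e1.symm
  · rw [h35, map_mul, h5, h7, mul_one]
    exact (show (ZMod.χ₈.ringHomComp (Int.castRingHom ℂ)) ((5 : ZMod 8) * 7) = -1 by
      rw [show (5 : ZMod 8) * 7 = 3 by decide]; exact e3).symm
  · rw [h5]; exact e5.symm
  · rw [h7]; exact e7.symm

/-- **`θ · χ₈` is PRIMITIVE mod `2^{m+1}` for `θ` primitive and `m ≥ 3`** (`χ₈` has conductor dividing
`8 ∣ 2^m`, so it cannot lower the conductor `2^{m+1}` of `θ`; `χ₈² = 1`).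
[cite: MontgomeryVaughan2007, §9.1 (primitive characters)] -/
theorem isPrimitive_mul_chi8_changeLevel {m : ℕ} (hm : 3 ≤ m) (h8 : 8 ∣ 2 ^ (m + 1))
    {θ : DirichletCharacter ℂ (2 ^ (m + 1))} (hθ : θ.IsPrimitive) :
    (θ * DirichletCharacter.changeLevel h8 (ZMod.χ₈.ringHomComp (Int.castRingHom ℂ))).IsPrimitive := by
  set ε := DirichletCharacter.changeLevel h8 (ZMod.χ₈.ringHomComp (Int.castRingHom ℂ)) with hε
  set ϑ := θ * ε with hϑ
  rw [DirichletCharacter.isPrimitive_def]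
  by_contra hne
  have hdvd : ϑ.conductor ∣ 2 ^ (m + 1) := DirichletCharacter.conductor_dvd_level _
  obtain ⟨k, hk, hkeq⟩ := (Nat.dvd_prime_pow Nat.prime_two).mp hdvd
  have hkm : k ≤ m := by
    by_contra hkm
    exact hne (by rw [hkeq, show k = m + 1 by omega])
  have hϑm : ϑ.conductor ∣ 2 ^ m := by rw [hkeq]; exact pow_dvd_pow 2 hkm
  -- `cond ε ∣ 8 ∣ 2^m`
  have h8m : 8 ∣ 2 ^ m := by
    rw [show (8 : ℕ) = 2 ^ 3 by norm_num]; exact pow_dvd_pow 2 hm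
  have hεfac : ε.FactorsThrough 8 :=
    DirichletCharacter.changeLevel_factorsThrough (ZMod.χ₈.ringHomComp (Int.castRingHom ℂ)) h8
  have hεm : ε.conductor ∣ 2 ^ m :=
    (DirichletCharacter.conductor_dvd_of_mem_conductorSet _ hεfac).trans h8m
  -- `ε² = 1`, so `θ = ϑ ε`
  have hεε : ε * ε = 1 := by
    rw [hε, ← map_mul, ← sq, (ZMod.isQuadratic_χ₈.comp _).sq_eq_one, map_one]
  have hθeq : θ = ϑ * ε := by rw [hϑ, mul_assoc, hεε, mul_one]
  have hcond : θ.conductor ∣ 2 ^ m := by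
    rw [hθeq]
    exact (DirichletCharacter.conductor_mul_dvd_lcm_conductor ϑ ε).trans (Nat.lcm_dvd hϑm hεm)
  rw [hθ] at hcond
  have := (Nat.pow_dvd_pow_iff_le_right (by norm_num : 1 < 2)).mp hcond
  omega

/-- An even `θ` times `χ₈` is even. [cite: MontgomeryVaughan2007, §9.1] -/
theorem even_mul_chi8_changeLevel {m : ℕ} (h8 : 8 ∣ 2 ^ (m + 1))
    {θ : DirichletCharacter ℂ (2 ^ (m + 1))} (heven : θ.Even) :
    (θ * DirichletCharacter.changeLevel h8 (ZMod.χ₈.ringHomComp (Int.castRingHom ℂ))).Even := by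
  rw [DirichletCharacter.Even, MulChar.coeToFun_mul, Pi.mul_apply, heven, one_mul]
  exact chi8_changeLevel_even h8

/-- **Every Dirichlet character mod `2^n` (values in a domain) has `2`-power order**: `χ^{2^n} = 1`
since `u^{2^n} = 1` for every unit `u` of `ℤ/2^n` (`#(ℤ/2^n)^× = 2^{n−1} ∣ 2^n`). At `p = 2` ALL characters
of `2`-power conductor are characters of `Γ = ℤ₂^×/{±1}` or its odd twin; the typed range keeps the even
ones. [cite: MazurTateTeitelbaum1986Invent, §I.13] -/
theorem exists_orderOf_eq_two_pow {R : Type*} [CommRing R] [IsDomain R] {n : ℕ}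
    (χ : DirichletCharacter R (2 ^ n)) : ∃ j : ℕ, orderOf χ = 2 ^ j := by
  have htot : Nat.totient (2 ^ n) ∣ 2 ^ n := by
    rcases Nat.eq_zero_or_pos n with hn | hn
    · rw [hn, pow_zero, Nat.totient_one]
    · rw [Nat.totient_prime_pow Nat.prime_two hn]
      exact ⟨2, by rw [show (2 : ℕ) - 1 = 1 by norm_num, mul_one, ← pow_succ, Nat.sub_add_cancel hn]⟩
  have hpow : χ ^ (2 ^ n) = 1 := by
    refine MulChar.ext fun u ↦ ?_
    obtain ⟨c, hc⟩ := htot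
    have hu : u ^ (2 ^ n) = 1 := by
      have h1 : u ^ (Nat.totient (2 ^ n) * c) = 1 := by
        rw [pow_mul, ← ZMod.card_units_eq_totient, pow_card_eq_one, one_pow]
      rwa [← hc] at h1
    rw [MulChar.pow_apply_coe, ← map_pow, ← Units.val_pow_eq_pow_val, hu, Units.val_one, map_one,
      MulChar.one_apply_coe]
  obtain ⟨j, -, hj⟩ := (Nat.dvd_prime_pow Nat.prime_two).mp (orderOf_dvd_of_pow_eq_one hpow)
  exact ⟨j, hj⟩

variable (ι : PadicAlgCl 2 ≃+* ℂ) (K : Type) [Field K] [NumberField K] [IsGalois ℚ K]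

/-- **The line character at a point `θ` of level `2^{m+1} ≥ 8` is `(θχ₈) ∘ N`**:
`χ₈∘N · θ∘N = (θ·χ₈)∘N` with `χ₈` raised to the level of `θ` (`ψ_θ` is multiplicative and independent
of the level presentation: `HeckeCharacter.ofDirichlet_mul`, `HeckeCharacter.ofDirichlet_changeLevel`).
[cite: Disegni2017, §1.2 (the line {χ·χ_F∘N}; arXiv v3 PDF p. 6)] [cite: NeukirchANT1999, Ch. VII §6 Prop. (6.9)] -/
theorem baseChangeDirichlet_chi8_mul {m : ℕ} (h8 : 8 ∣ 2 ^ (m + 1))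
    (θ : DirichletCharacter ℂ (2 ^ (m + 1))) :
    baseChangeDirichlet K (ZMod.χ₈.ringHomComp (Int.castRingHom ℂ)) * baseChangeDirichlet K θ =
      baseChangeDirichlet K
        (θ * DirichletCharacter.changeLevel h8 (ZMod.χ₈.ringHomComp (Int.castRingHom ℂ))) := by
  rw [baseChangeDirichlet_def, baseChangeDirichlet_def, baseChangeDirichlet_def,
    ← HeckeCharacter.ofDirichlet_changeLevel h8, ← HeckeCharacter.compRelNorm_mul,
    ← HeckeCharacter.ofDirichlet_mul, mul_comm]

/-- **At `θ = χ₈` the line character is trivial**: `χ₈∘N · χ₈∘N = (χ₈²)∘N = 𝟙_K` — the UNRAMIFIED point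
of the `χ₈∘N`-line. [cite: Disegni2017, §1.2 and Def. 1.3.3 (arXiv v3 PDF pp. 6–7)] -/
theorem baseChangeDirichlet_chi8_mul_self :
    baseChangeDirichlet K (ZMod.χ₈.ringHomComp (Int.castRingHom ℂ)) *
        baseChangeDirichlet K (ZMod.χ₈.ringHomComp (Int.castRingHom ℂ) : DirichletCharacter ℂ (2 ^ 3)) =
      1 := by
  show baseChangeDirichlet K (ZMod.χ₈.ringHomComp (Int.castRingHom ℂ)) *
      baseChangeDirichlet K (ZMod.χ₈.ringHomComp (Int.castRingHom ℂ)) = 1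
  rw [baseChangeDirichlet_def, ← HeckeCharacter.compRelNorm_mul, ← HeckeCharacter.ofDirichlet_mul,
    ← sq, (ZMod.isQuadratic_χ₈.comp _).sq_eq_one]
  exact baseChangeDirichlet_one (K := K)

/-- **The `χ₈`-coset of the cyclotomic variable is `T ↦ −T−2`**: for `θ` of level `2^{m+1} ≥ 8`,
`cycLinePoint ι (θχ₈) = −cycLinePoint ι θ − 2` (`(θχ₈)(γ) = −θ(γ)` as `χ₈(5) = −1`, `γ = 5`; the point of a
character `ψ` being `ι⁻¹(ψ(γ))⁻¹ − 1`). At `p = 2` this reflection preserves the open unit disc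
(`‖2‖₂ < 1`). [cite: MazurTateTeitelbaum1986Invent, §I.13] [cite: Disegni2017, Theorem A (arXiv v3 PDF p. 7)] -/
theorem cycLinePoint_mul_chi8 {m : ℕ} (h8 : 8 ∣ 2 ^ (m + 1)) (θ : DirichletCharacter ℂ (2 ^ (m + 1))) :
    cycLinePoint ι (θ * DirichletCharacter.changeLevel h8 (ZMod.χ₈.ringHomComp (Int.castRingHom ℂ))) =
      -cycLinePoint ι θ - 2 := by
  rw [cycLinePoint, cycLinePoint, MulChar.coeToFun_mul, Pi.mul_apply, cyclotomicGenerator_two,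
    chi8_changeLevel_five h8, mul_neg, mul_one, map_neg, PadicComplex.coe_eq, map_neg, inv_neg,
    ← PadicComplex.coe_eq]
  ring

end TwoPoints

/-! ### §3 `p = 2`: STEP A₂ — Disegni's interpolation values on the `χ₈ ∘ N`-line -/

section StepA

variable (ι : PadicAlgCl 2 ≃+* ℂ) (K : Type) [Field K] [NumberField K] [IsGalois ℚ K]

/-- ★ **STEP A₂ at the base point `θ = 𝟙` (level `2`) of the `χ₈∘N`-line** (`K` quadratic, `2` split,
`𝔭, 𝔭′ ∋ 2`; `f, f′` rational newforms; `α ∈ ℚ₂`, `a = ι(α)`): the line character is `χ₈∘N` itself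
(conductor `8` at both places), and for any entire continuations `Λ₁, Λ₂` of `L(f⊗χ₈, s)`, `L(f′⊗χ₈, s)`:
`chiLineValue(θ = 𝟙) = c · (α⁻³ Σ_b χ₈(b)[b/8]⁺_f) · (α⁻³ Σ_b χ₈(b)[b/8]⁺_{f′})`, `c = ι⁻¹(u·Car·Ω⁺_f·Ω⁺_{f′})`
(`u = 16/3`) — the two factors being the MTT values of `L₂(f,α,T)`, `L₂(f′,α,T)` at the conductor-`8`
character, i.e. at `T = χ₈(5) − 1 = −2`. [cite: Disegni2017, Theorem A (arXiv v3 PDF pp. 6–7)]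
[cite: MazurTateTeitelbaum1986Invent, §I.8 (8.6), §I.14 (14.3)] -/
theorem chiLineValue_chi8_level_two (h2 : Module.finrank ℚ K = 2)
    (hsplit : ((Ideal.span {(2 : ℤ)}).primesOver (𝓞 K)).ncard = 2)
    (𝔭 𝔭' : HeightOneSpectrum (𝓞 K)) (h𝔭 : ((2 : ℕ) : 𝓞 K) ∈ 𝔭.asIdeal)
    (h𝔭' : ((2 : ℕ) : 𝓞 K) ∈ 𝔭'.asIdeal)
    {N N' : ℕ} [NeZero N] [NeZero N'] {f : CuspForm (Gamma0 N) 2} {f' : CuspForm (Gamma0 N') 2}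
    (hf : IsNewform0 f) (hQ : coeffField f = ⊥) (hf' : IsNewform0 f') (hQ' : coeffField f' = ⊥)
    (α : ℚ_[2]) (Car : ℝ) (θ : DirichletCharacter ℂ (2 ^ (0 + 1))) {Λ₁ Λ₂ : ℂ → ℂ}
    (hΛ₁ : Differentiable ℂ Λ₁)
    (hΛ₁' : ∀ s : ℂ, 2 < s.re → Λ₁ s =
      twistedLSeries f (ZMod.χ₈.ringHomComp (Int.castRingHom ℂ) : DirichletCharacter ℂ (2 ^ 3)) s)
    (hΛ₂ : Differentiable ℂ Λ₂)
    (hΛ₂' : ∀ s : ℂ, 2 < s.re → Λ₂ s =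
      twistedLSeries f' (ZMod.χ₈.ringHomComp (Int.castRingHom ℂ) : DirichletCharacter ℂ (2 ^ 3)) s) :
    chiLineValue ι K (ι ((α : PadicAlgCl 2))) N
        (baseChangeDirichlet K (ZMod.χ₈.ringHomComp (Int.castRingHom ℂ))) 𝔭 𝔭' θ Car (Λ₁ 1 * Λ₂ 1) =
      ((ι.symm ((splitLocalConstant 2 : ℂ) * (Car : ℂ) * (plusPeriod f : ℂ) * (plusPeriod f' : ℂ)) :
          PadicAlgCl 2) : ℂ_[2]) *
        (algebraMap ℚ_[2] ℂ_[2] (α⁻¹ ^ 3) *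
          ratTwistedSymbolSum f
            (((ZMod.χ₈.ringHomComp (Int.castRingHom ℂ) : DirichletCharacter ℂ (2 ^ 3))⁻¹.ringHomComp
              ι.symm.toRingHom).ringHomComp (algebraMap (PadicAlgCl 2) ℂ_[2]))) *
        (algebraMap ℚ_[2] ℂ_[2] (α⁻¹ ^ 3) *
          ratTwistedSymbolSum f'
            (((ZMod.χ₈.ringHomComp (Int.castRingHom ℂ) : DirichletCharacter ℂ (2 ^ 3))⁻¹.ringHomComp
              ι.symm.toRingHom).ringHomComp (algebraMap (PadicAlgCl 2) ℂ_[2]))) := by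
  haveI : NeZero (2 ^ 3) := ⟨by norm_num⟩
  rw [chiLineValue, dirichletCharacter_level_two_eq_one θ, baseChangeDirichlet_one, mul_one]
  exact chiLineComplexPart_eq_of_isPrimitive ι K h2 hsplit 𝔭 𝔭' h𝔭 h𝔭' (n := 3) (by norm_num)
    (isPrimitive_χ₈_ringHomComp_of_charZero ℂ) chi8_even hf hQ hf' hQ' α Car hΛ₁ hΛ₁' hΛ₂ hΛ₂'

/-- ★ **STEP A₂ at the point `θ = χ₈` of the `χ₈∘N`-line** — the UNRAMIFIED point (`χ₈² = 𝟙`): for `θ`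
even and primitive mod `8` (necessarily `θ = χ₈`), `2 ∤ N`, `α` a `2`-adic unit, and entire continuations
`Λ₁, Λ₂` of `L(f, s)`, `L(f′, s)`:
`chiLineValue(θ) = c · (1−α⁻¹)²[0]⁺_f · (1−α⁻¹)²[0]⁺_{f′}` — the two factors being the constant terms
`L₂(f,α,0)`, `L₂(f′,α,0)` (`constantCoeff_padicLFunction_unitRoot`), i.e. the MTT functions at `T = 0 =
−(−2) − 2`, the reflection of the point `T = −2` of `θ = χ₈`. [cite: Disegni2017, Theorem A (arXiv v3 PDF pp. 6–7)]
[cite: MazurTateTeitelbaum1986Invent, §I.14 (14.3)] -/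
theorem chiLineValue_chi8_self (𝔭 𝔭' : HeightOneSpectrum (𝓞 K))
    {N N' : ℕ} [NeZero N] [NeZero N'] (hN : ¬ 2 ∣ N) {f : CuspForm (Gamma0 N) 2}
    {f' : CuspForm (Gamma0 N') 2}
    (hf : IsNewform0 f) (hQ : coeffField f = ⊥) (hf' : IsNewform0 f') (hQ' : coeffField f' = ⊥)
    {α : ℚ_[2]} (hα : ‖α‖ = 1) (Car : ℝ) {θ : DirichletCharacter ℂ (2 ^ (2 + 1))} (heven : θ.Even)
    (hprim : θ.IsPrimitive) {Λ₁ Λ₂ : ℂ → ℂ} (hΛ₁ : Differentiable ℂ Λ₁)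
    (hΛ₁' : ∀ s : ℂ, 2 < s.re → Λ₁ s = twistedLSeries f (1 : DirichletCharacter ℂ 1) s)
    (hΛ₂ : Differentiable ℂ Λ₂)
    (hΛ₂' : ∀ s : ℂ, 2 < s.re → Λ₂ s = twistedLSeries f' (1 : DirichletCharacter ℂ 1) s) :
    chiLineValue ι K (ι ((α : PadicAlgCl 2))) N
        (baseChangeDirichlet K (ZMod.χ₈.ringHomComp (Int.castRingHom ℂ))) 𝔭 𝔭' θ Car (Λ₁ 1 * Λ₂ 1) =
      ((ι.symm ((splitLocalConstant 2 : ℂ) * (Car : ℂ) * (plusPeriod f : ℂ) * (plusPeriod f' : ℂ)) :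
          PadicAlgCl 2) : ℂ_[2]) *
        algebraMap ℚ_[2] ℂ_[2] ((1 - α⁻¹) ^ 2 * (ratPlusSymbol f 0 : ℚ_[2])) *
        algebraMap ℚ_[2] ℂ_[2] ((1 - α⁻¹) ^ 2 * (ratPlusSymbol f' 0 : ℚ_[2])) := by
  rw [chiLineValue, eq_chi8_of_even_of_isPrimitive θ heven hprim, baseChangeDirichlet_chi8_mul_self]
  exact chiLineComplexPart_one ι K 𝔭 𝔭' hN hf hQ hf' hQ' hα Car hΛ₁ hΛ₁' hΛ₂ hΛ₂'

/-- ★ **STEP A₂ at the points `θ` of level `2^{m+1} ≥ 16` of the `χ₈∘N`-line** (`θ` primitive and even,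
`m ≥ 3`; `ξ := θχ₈` is then primitive and even of conductor `2^{m+1}`): for any entire continuations
`Λ₁, Λ₂` of `L(f⊗ξ, s)`, `L(f′⊗ξ, s)`,
`chiLineValue(θ) = c · (α^{−(m+1)} Σ_b χ_ξ(b)[b/2^{m+1}]⁺_f) · (α^{−(m+1)} Σ_b χ_ξ(b)[b/2^{m+1}]⁺_{f′})` —
the two factors being the MTT values of `L₂(f,α,T)`, `L₂(f′,α,T)` at the twin `χ_ξ`, i.e. at
`T = χ_ξ(5) − 1 = −(cycLinePoint ι θ) − 2` (`cycLinePoint_mul_chi8`).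
[cite: Disegni2017, Theorem A (arXiv v3 PDF pp. 6–7)] [cite: MazurTateTeitelbaum1986Invent, §I.8 (8.6), §I.14 (14.3)] -/
theorem chiLineValue_chi8_of_three_le (h2 : Module.finrank ℚ K = 2)
    (hsplit : ((Ideal.span {(2 : ℤ)}).primesOver (𝓞 K)).ncard = 2)
    (𝔭 𝔭' : HeightOneSpectrum (𝓞 K)) (h𝔭 : ((2 : ℕ) : 𝓞 K) ∈ 𝔭.asIdeal)
    (h𝔭' : ((2 : ℕ) : 𝓞 K) ∈ 𝔭'.asIdeal)
    {N N' : ℕ} [NeZero N] [NeZero N'] {f : CuspForm (Gamma0 N) 2} {f' : CuspForm (Gamma0 N') 2}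
    (hf : IsNewform0 f) (hQ : coeffField f = ⊥) (hf' : IsNewform0 f') (hQ' : coeffField f' = ⊥)
    (α : ℚ_[2]) (Car : ℝ) {m : ℕ} (hm : 3 ≤ m) (h8 : 8 ∣ 2 ^ (m + 1))
    {θ : DirichletCharacter ℂ (2 ^ (m + 1))} (heven : θ.Even) (hprim : θ.IsPrimitive)
    {Λ₁ Λ₂ : ℂ → ℂ} (hΛ₁ : Differentiable ℂ Λ₁)
    (hΛ₁' : ∀ s : ℂ, 2 < s.re → Λ₁ s = twistedLSeries f
      (θ * DirichletCharacter.changeLevel h8 (ZMod.χ₈.ringHomComp (Int.castRingHom ℂ))) s)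
    (hΛ₂ : Differentiable ℂ Λ₂)
    (hΛ₂' : ∀ s : ℂ, 2 < s.re → Λ₂ s = twistedLSeries f'
      (θ * DirichletCharacter.changeLevel h8 (ZMod.χ₈.ringHomComp (Int.castRingHom ℂ))) s) :
    chiLineValue ι K (ι ((α : PadicAlgCl 2))) N
        (baseChangeDirichlet K (ZMod.χ₈.ringHomComp (Int.castRingHom ℂ))) 𝔭 𝔭' θ Car (Λ₁ 1 * Λ₂ 1) =
      ((ι.symm ((splitLocalConstant 2 : ℂ) * (Car : ℂ) * (plusPeriod f : ℂ) * (plusPeriod f' : ℂ)) :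
          PadicAlgCl 2) : ℂ_[2]) *
        (algebraMap ℚ_[2] ℂ_[2] (α⁻¹ ^ (m + 1)) *
          ratTwistedSymbolSum f
            (((θ * DirichletCharacter.changeLevel h8 (ZMod.χ₈.ringHomComp (Int.castRingHom ℂ)))⁻¹.ringHomComp
              ι.symm.toRingHom).ringHomComp (algebraMap (PadicAlgCl 2) ℂ_[2]))) *
        (algebraMap ℚ_[2] ℂ_[2] (α⁻¹ ^ (m + 1)) *
          ratTwistedSymbolSum f'
            (((θ * DirichletCharacter.changeLevel h8 (ZMod.χ₈.ringHomComp (Int.castRingHom ℂ)))⁻¹.ringHomComp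
              ι.symm.toRingHom).ringHomComp (algebraMap (PadicAlgCl 2) ℂ_[2]))) := by
  rw [chiLineValue, baseChangeDirichlet_chi8_mul K h8 θ]
  exact chiLineComplexPart_eq_of_isPrimitive ι K h2 hsplit 𝔭 𝔭' h𝔭 h𝔭' (n := m + 1) (Nat.succ_pos m)
    (isPrimitive_mul_chi8_changeLevel hm h8 hprim) (even_mul_chi8_changeLevel h8 heven) hf hQ hf' hQ' α
    Car hΛ₁ hΛ₁' hΛ₂ hΛ₂'

end StepA

end Summit.BirchSwinnertonDyer.BirchSwinnertonDyer.Theorems.PrintCf2.DisegniPairTwo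

end
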